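import Summits.BirchSwinnertonDyer.BirchSwinnertonDyer.Theorems.PrintCf2SplitBadTwoDyadicTorsionThreeModEight
import Summits.BirchSwinnertonDyer.BirchSwinnertonDyer.Theorems.PrintCf2SplitBadRubinValueTwoAnchorsSixSixtyTwo
import Summits.BirchSwinnertonDyer.BirchSwinnertonDyer.Theorems.GoldfeldAllTwistsTwoConverseTwinAdditiveTamagawaTwoSeven
import Summits.BirchSwinnertonDyer.BirchSwinnertonDyer.Theorems.GoldfeldAllTwistsTwoConverseTwinAdditiveTorsion
import Summits.BirchSwinnertonDyer.Rank1Residual.Additive.LocalLogImageRat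
import Literature.NumberTheory.EllipticCurves.VariableChangePointsMap
import Literature.NumberTheory.EllipticCurves.BSDQuadraticDescentTorsionOddPartProofs
import HarnessLib

set_option linter.dupNamespace false -- `…BirchSwinnertonDyer.BirchSwinnertonDyer…` is the cell's namespace (D-0017)
set_option autoImplicit false

/-!
# The DYADIC TORSION TABLE of the split-bad class, III: the count `#W(ℚ₂)[2^∞] = 8` on `d ≡ 3 (mod 8)`, and the
# table read on cell bsd-goldfeld's global minimal model `X_d = X₀(49)^{(4d)}` — `t([d]₂)`, `log_ω(X_d(ℚ₂))`

Cell `bsd-print-cf2`, width seat `bsd-line-cf2-p1-w4` g6 (`--supports stmt-BirchSwinnertonDyer-20368`, crux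
`PrintCf2.SplitBadTwoRankOneOfFacts`, road α, skeleton of record v8). Theses-free; theorems only; no `sorry`. HONEST
FRAMING: 2-adic bookkeeping on an explicit family; nothing about `L`-values; BSD is not proved by any of this and no
summit statement is proved by this seat.

ASSEMBLY of the two siblings (`…DyadicTorsion`, `…DyadicTorsionThreeModEight`) with the tree:
* §1 `#V(ℚ₂)[2^∞] = 8` for `u ≡ 3 (mod 8)`: `V(ℚ₂)[2^∞] = V[2] ⊔ (Q₀ + V[2])` with `2Q₀ = T₋` (halves of `T₋` are
  not halvable, `T₀`, `T₊` are not halvable), both cosets of size `4`.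
* §2 transport: `#E(K)[p^∞]` is invariant under isomorphisms of point groups (tree
  `natCard_primaryComponent_congr`); every model `W` of `49a1^{(d)}`
  (`C • W = cm7.quadraticTwist d`) is `ℚ`-isomorphic to the two-torsion model `[0, 21d, 0, 112d², 0]`.
* §3 THE TABLE on `X_d := cm7.quadraticTwist (4d)` (`= M_d ⊗ ℚ`, bsd-goldfeld's GLOBAL MINIMAL model of the whole
  additive cell, `isGloballyMinimal_cellTwist`), `d` squarefree, `d ≢ 1 (mod 4)`:
  **`#X_d(ℚ₂)[2^∞] = 8` and `t = v₂ #X_d(ℚ₂)_tors = 3` if `d ≡ 3 (mod 8)`, else `4` and `t = 2`**; and, feeding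
  bsd-goldfeld's `c₂(X_d) = 4` (`localTamagawaNumber_padic_cellTwist_two`) and additive reduction at `2`
  (`additive_two_seven_cellTwist`) into b2b-bsdres' `range_padicLog_baseChange_of_addv`
  (`log_ω(E(ℚ_p)) = p^{t − v_p c_p}ℤ_p`): **`log_ω(X_d(ℚ₂)) = 2ℤ₂` if `d ≡ 3 (mod 8)`, `= ℤ₂` otherwise** —
  the 2-adic-key dependence (`[d]₂ = (1,3)` vs the five other classes) that the explicit local tables of the
  research stubs S2′ (`stub_rubinValueFormula_two`) / S3b (`stub_ellipticUnitDescent_two`) and the children's T2/T3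
  must carry (the `ℓ = ord₂ log_ω(P)` of the stubs versus the index of `P` in `W(ℚ₂)/tors`).
* §4 the same count for EVERY model `W` of `49a1^{(d)}` (the binder shape of S2′/S3b: `C • W = cm7.quadraticTwist d`).

References: [SilvermanTate2015] §3.5; [SilvermanAEC2009] IV.6.4, VII.6.3, X.1; [Serre1973] Ch. II §3.3 Thm 4;
[Kim2022StructureSelmer] §3.2.3, Lemma 3.10.
-/

noncomputable section

open scoped Classical

open WeierstrassCurve Literature.NumberTheory.QuadraticForms Literature.NumberTheory.EllipticCurves
open Summit.BirchSwinnertonDyer.Rank1Residual.Additive.LocalLog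

namespace Summit.BirchSwinnertonDyer.BirchSwinnertonDyer.Theorems.PrintCf2.DyadicTorsion

/-! ## §1 The count on the class `u ≡ 3 (mod 8)` -/

section Count

variable (V : WeierstrassCurve ℚ_[2]) [V.IsTwoTorsionNF] [V.IsElliptic] {u : ℤ}
  (ha : V.a₂ = 21 * (u : ℚ_[2])) (hb : V.a₄ = 112 * (u : ℚ_[2]) ^ 2)

include ha hb in
/-- **CLASS II, THE DYADIC TORSION: `#V(ℚ₂)[2^∞] = 8`** for `V : y² = x³ + 21u x² + 112u² x` over `ℚ₂` with
`u ≡ 3 (mod 8)` — `V(ℚ₂)[2^∞] = V[4] = V[2] ⊔ (Q₀ + V[2])`, `2Q₀ = T₋`, i.e. `V(ℚ₂)[2^∞] ≅ ℤ/4 × ℤ/2` and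
`t([d]₂) = 3` on the 2-adic key `(1,3)` of the split-bad class `49a1^{(d)}`.
[cite: SilvermanTate2015, §3.5] [cite: Serre1973, Ch. II §3.3 Thm 4] -/
theorem natCard_primaryComponent_two_classII (hu : u % 8 = 3) :
    Nat.card (AddCommGroup.primaryComponent V.toAffine.Point 2) = 8 := by
  have hu0 : u ≠ 0 := by omega
  obtain ⟨s, r, hs, hsr⟩ := exists_sq_eq_neg_seven_fine
  have hs' : ((s : ℚ_[2])) ^ 2 = -7 := by exact_mod_cast congrArg ((↑) : ℤ_[2] → ℚ_[2]) hs
  obtain ⟨hsum, hprod⟩ := roots_of_sq_eq V ha hb hs'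
  obtain ⟨hrp, hrm⟩ := root_of_sum_prod V hsum hprod
  set xp : ℚ_[2] := (-21 * (u : ℚ_[2]) + u * s) / 2 with hxp
  set xm : ℚ_[2] := (-21 * (u : ℚ_[2]) - u * s) / 2 with hxm
  have hu' : (u : ℚ_[2]) ≠ 0 := by exact_mod_cast hu0
  have hsu : IsUnit s := isUnit_of_sq_eq_intCast (c := -7) (by decide) (by rw [hs]; norm_num)
  have hs0 : (s : ℚ_[2]) ≠ 0 := by rw [PadicInt.coe_ne_zero]; exact hsu.ne_zero
  have hpm : xp ≠ xm := by
    intro h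
    have : (u : ℚ_[2]) * s = 0 := by rw [← root_sub_root (u := u) (s : ℚ_[2]), ← hxp, ← hxm, h, sub_self]
    exact mul_ne_zero hu' hs0 this
  have hp0 : xp ≠ 0 := fun h => V.a₄_ne_zero (by rw [← hprod, h, zero_mul])
  have hm0 : xm ≠ 0 := fun h => V.a₄_ne_zero (by rw [← hprod, h, mul_zero])
  have hT0 := V.nonsingular_zero_zero
  have hTp : V.toAffine.Nonsingular xp 0 := nonsingular_root V hrp
  have hTm : V.toAffine.Nonsingular xm 0 := nonsingular_root V hrm
  -- the four-element set of points killed by `2`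
  set S₂ : Set V.toAffine.Point := {0, .some 0 0 hT0, .some xp 0 hTp, .some xm 0 hTm} with hS₂
  have hmem₂ : ∀ P : V.toAffine.Point, 2 • P = 0 ↔ P ∈ S₂ := by
    intro P
    rw [two_nsmul_eq_zero_iff_of_roots V hsum hprod P, hS₂]
    simp only [Set.mem_insert_iff, Set.mem_singleton_iff]
    constructor
    · rintro (h | ⟨x, hx, hx3, rfl⟩)
      · exact Or.inl h
      · rcases hx3 with rfl | rfl | rfl
        · exact Or.inr (Or.inl rfl)
        · exact Or.inr (Or.inr (Or.inl rfl))
        · exact Or.inr (Or.inr (Or.inr rfl))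
    · rintro (rfl | rfl | rfl | rfl)
      · exact Or.inl rfl
      · exact Or.inr ⟨_, hT0, Or.inl rfl, rfl⟩
      · exact Or.inr ⟨_, hTp, Or.inr (Or.inl rfl), rfl⟩
      · exact Or.inr ⟨_, hTm, Or.inr (Or.inr rfl), rfl⟩
  have hS₂card : S₂.ncard = 4 := by
    rw [hS₂, Set.ncard_insert_of_notMem (by simp) (by simp),
      Set.ncard_insert_of_notMem (by simp [hp0.symm, hm0.symm]) (by simp), Set.ncard_pair (by simp [hpm])]
  have hS₂fin : S₂.Finite := by rw [hS₂]; exact Set.toFinite _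
  -- the order-4 point and the obstruction lemmas
  obtain ⟨Q₀, hQ₀⟩ := exists_two_nsmul_eq_Tminus V ha hb hu hs hsr hTm
  have h4 : ∀ P : V.toAffine.Point, 2 • (2 • P) = 0 → 2 • P = 0 ∨ 2 • P = .some xm 0 hTm := by
    intro P hP
    rcases (two_nsmul_eq_zero_iff_of_roots V hsum hprod (2 • P)).mp hP with h0 | ⟨x, hx, hx3, hPx⟩
    · exact Or.inl h0
    · rcases hx3 with rfl | rfl | rfl
      · exact absurd hPx (two_nsmul_ne_twoTorsionPoint V hb hu0 P)
      · exact absurd hPx (two_nsmul_ne_Tplus V ha hb hu hs hsr P)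
      · exact Or.inr hPx
  have hkill : ∀ (k : ℕ) (P : V.toAffine.Point), 2 ^ k • P = 0 → 2 • (2 • P) = 0 := by
    intro k
    induction k with
    | zero => intro P hP; rw [pow_zero, one_nsmul] at hP; rw [hP, nsmul_zero, nsmul_zero]
    | succ k ih =>
      intro P hP
      rw [pow_succ', mul_nsmul] at hP
      have h8 := ih (2 • P) hP
      rcases h4 (2 • P) h8 with h0 | hT
      · exact h0
      · exact absurd hT (not_two_nsmul_two_nsmul_eq_Tminus V ha hb hu hs hsr P)
  -- the carrier is `S₂ ∪ (Q₀ + S₂)`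
  set F : Set V.toAffine.Point := (fun T => T + Q₀) '' S₂ with hF
  have hmemF : ∀ P : V.toAffine.Point, 2 • P = .some xm 0 hTm ↔ P ∈ F := by
    intro P
    rw [hF, Set.mem_image]
    constructor
    · intro hP
      refine ⟨P - Q₀, (hmem₂ _).mp ?_, sub_add_cancel P Q₀⟩
      rw [nsmul_sub, hP, hQ₀, sub_self]
    · rintro ⟨T, hT, rfl⟩
      rw [nsmul_add, (hmem₂ T).mpr hT, hQ₀, zero_add]
  have hset : (AddCommGroup.primaryComponent V.toAffine.Point 2 : Set V.toAffine.Point) = S₂ ∪ F := by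
    ext P
    simp only [SetLike.mem_coe, AddCommGroup.mem_primaryComponent, Set.mem_union]
    constructor
    · rintro ⟨k, hk⟩
      rcases h4 P (hkill k P hk) with h0 | hT
      · exact Or.inl ((hmem₂ P).mp h0)
      · exact Or.inr ((hmemF P).mp hT)
    · rintro (hP | hP)
      · exact ⟨1, by rw [pow_one]; exact (hmem₂ P).mpr hP⟩
      · refine ⟨2, ?_⟩
        rw [show (2 : ℕ) ^ 2 = 2 * 2 by norm_num, mul_nsmul, (hmemF P).mpr hP]
        exact (V.two_nsmul_eq_zero_iff_y_eq_zero hTm).mpr rfl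
  have hdisj : Disjoint S₂ F := by
    rw [Set.disjoint_left]
    intro P hP hP'
    have h1 := (hmem₂ P).mpr hP
    have h2 := (hmemF P).mpr hP'
    rw [h1] at h2
    exact Affine.Point.some_ne_zero _ h2.symm
  rw [← SetLike.coe_sort_coe, hset, Nat.card_coe_set_eq, Set.ncard_union_eq hdisj hS₂fin (hS₂fin.image _),
    Set.ncard_image_of_injective _ (add_left_injective Q₀), hS₂card]

end Count

/-! ## §2 Transport: isomorphic point groups, and the two-torsion model of every member of the class -/

/-- Every model of `49a1^{(d)}` is `ℚ`-isomorphic to the two-torsion model `[0, 21d, 0, 112d², 0]`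
(through bsd-goldfeld's cell model `M_d`). [cite: SilvermanAEC2009, X.5 Cor. 5.4] -/
theorem exists_smul_eq_twoTorsionModel {d : ℤ} (W : WeierstrassCurve ℚ) {C : VariableChange ℚ}
    (hC : C • W = cm7.quadraticTwist (d : ℚ)) :
    ∃ C' : VariableChange ℚ, C' • W = (⟨0, ((21 * d : ℤ) : ℚ), 0, ((112 * d ^ 2 : ℤ) : ℚ), 0⟩ : WeierstrassCurve ℚ) := by
  obtain ⟨C₀, hC₀⟩ := RubinValueTwoAnchor.exists_smul_twoTorsionModel_eq_cm7_quadraticTwist d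
  obtain ⟨C₁, hC₁⟩ := GoldfeldGoodTwists.exists_smul_eq_cellModel_baseChange W hC
  obtain ⟨C₂, hC₂⟩ := GoldfeldGoodTwists.exists_smul_eq_cellModel_baseChange _ hC₀
  exact ⟨C₂⁻¹ * C₁, by rw [mul_smul, hC₁, ← hC₂, inv_smul_smul]⟩

/-- The two-torsion model over `ℚ₂` has `a₂ = 21d`, `a₄ = 112d²`. [folklore] -/
theorem twoTorsionModel_baseChange_coeffs (d : ℤ) :
    ((⟨0, ((21 * d : ℤ) : ℚ), 0, ((112 * d ^ 2 : ℤ) : ℚ), 0⟩ : WeierstrassCurve ℚ).baseChange ℚ_[2]).a₂ =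
        21 * (d : ℚ_[2]) ∧
      ((⟨0, ((21 * d : ℤ) : ℚ), 0, ((112 * d ^ 2 : ℤ) : ℚ), 0⟩ : WeierstrassCurve ℚ).baseChange ℚ_[2]).a₄ =
        112 * (d : ℚ_[2]) ^ 2 := by
  constructor <;> simp [baseChange]

/-- **THE DYADIC TORSION COUNT for every model of `49a1^{(d)}`** (`d` squarefree, `d ≢ 1 (mod 4)`; the binder shape
`C • W = cm7.quadraticTwist d` of S2′/S3b): `#W(ℚ₂)[2^∞] = 8` if `d ≡ 3 (mod 8)` and `= 4` otherwise.
[cite: SilvermanTate2015, §3.5] [cite: Serre1973, Ch. II §3.3 Thm 4] -/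
theorem natCard_primaryComponent_two_of_smul_eq_quadraticTwist {d : ℤ} (hsq : Squarefree d) (hd4 : d % 4 ≠ 1)
    (W : WeierstrassCurve ℚ) [W.IsElliptic] {C : VariableChange ℚ} (hC : C • W = cm7.quadraticTwist (d : ℚ)) :
    Nat.card (AddCommGroup.primaryComponent (W.baseChange ℚ_[2]).toAffine.Point 2) = if d % 8 = 3 then 8 else 4 := by
  obtain ⟨C', hC'⟩ := exists_smul_eq_twoTorsionModel W hC
  set T : WeierstrassCurve ℚ := ⟨0, ((21 * d : ℤ) : ℚ), 0, ((112 * d ^ 2 : ℤ) : ℚ), 0⟩ with hT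
  haveI hTell : T.IsElliptic := by rw [← hC']; infer_instance
  haveI : (T.baseChange ℚ_[2]).IsTwoTorsionNF := by rw [hT]; infer_instance
  obtain ⟨ha, hb⟩ := twoTorsionModel_baseChange_coeffs d
  have e : (W.baseChange ℚ_[2]).toAffine.Point ≃+ (T.baseChange ℚ_[2]).toAffine.Point :=
    (VariableChange.pointEquivBaseChange W C' ℚ_[2]).trans (Affine.Point.congrEquiv (by rw [hC']))
  rw [Literature.NumberTheory.EllipticCurves.natCard_primaryComponent_congr e]
  split_ifs with h8
  · exact natCard_primaryComponent_two_classII (T.baseChange ℚ_[2]) ha hb h8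
  · refine natCard_primaryComponent_two_classI (T.baseChange ℚ_[2]) ha hb ?_
    rcases Int.emod_two_eq_zero_or_one d with he | ho
    · refine Or.inr ⟨d / 2, Int.odd_iff.mpr ?_, by omega⟩
      have h4 : ¬ (4 : ℤ) ∣ d := GoldfeldGoodTwists.not_four_dvd_of_squarefree hsq
      omega
    · left; omega

/-! ## §3 The table on bsd-goldfeld's global minimal model `X_d = X₀(49)^{(4d)}`: `t` and `log_ω(X_d(ℚ₂))` -/

section CellModel

variable {d : ℤ}

/-- **`#X_d(ℚ₂)[2^∞]`** on `X_d = cm7.quadraticTwist (4d)` (`d` squarefree, `d ≢ 1 (mod 4)`): `8` if `d ≡ 3 (mod 8)`,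
else `4`. [cite: SilvermanTate2015, §3.5] [cite: Serre1973, Ch. II §3.3 Thm 4] -/
theorem natCard_primaryComponent_two_cellTwist (hsq : Squarefree d) (hd4 : d % 4 ≠ 1) :
    Nat.card (AddCommGroup.primaryComponent
      ((cm7.quadraticTwist (((4 * d : ℤ)) : ℚ)).baseChange ℚ_[2]).toAffine.Point 2) = if d % 8 = 3 then 8 else 4 := by
  have hd : (((4 * d : ℤ)) : ℚ) ≠ 0 := by have := hsq.ne_zero; exact_mod_cast (show (4 * d : ℤ) ≠ 0 by omega)
  haveI := cm7.isElliptic_quadraticTwist hd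
  have h : (⟨(Units.mk0 (2 : ℚ) two_ne_zero)⁻¹, 0, 0, 0⟩ : VariableChange ℚ)⁻¹ •
      cm7.quadraticTwist (((4 * d : ℤ)) : ℚ) = cm7.quadraticTwist (d : ℚ) := by
    rw [inv_smul_eq_iff, show (((4 * d : ℤ)) : ℚ) = (2 : ℚ) ^ 2 * (d : ℚ) by push_cast; ring]
    exact cm7.quadraticTwist_sq_mul two_ne_zero _
  exact natCard_primaryComponent_two_of_smul_eq_quadraticTwist hsq hd4 _ h

/-- **`t([d]₂) = v₂ #X_d(ℚ₂)_tors ∈ {2, 3}`**: `3` if `d ≡ 3 (mod 8)`, else `2` (`#E(ℚ_p)[p^∞] = p^t`, tree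
`natCard_primaryComponent_point_eq_pow`). [cite: Kim2022StructureSelmer, Lemma 3.10] -/
theorem padicValNat_card_torsion_cellTwist (hsq : Squarefree d) (hd4 : d % 4 ≠ 1) :
    padicValNat 2 (Nat.card (AddCommGroup.torsion
      ((cm7.quadraticTwist (((4 * d : ℤ)) : ℚ)).baseChange ℚ_[2]).toAffine.Point)) = if d % 8 = 3 then 3 else 2 := by
  have hd : (((4 * d : ℤ)) : ℚ) ≠ 0 := by have := hsq.ne_zero; exact_mod_cast (show (4 * d : ℤ) ≠ 0 by omega)
  haveI := cm7.isElliptic_quadraticTwist hd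
  haveI := GoldfeldGoodTwists.isGloballyMinimal_cellTwist hsq hd4
  have h := natCard_primaryComponent_point_eq_pow (p := 2) ((cm7.quadraticTwist (((4 * d : ℤ)) : ℚ)).baseChange ℚ_[2])
  rw [natCard_primaryComponent_two_cellTwist hsq hd4] at h
  split_ifs at h ⊢ with h8
  · exact (Nat.pow_right_injective le_rfl (h.symm.trans (by norm_num : (8 : ℕ) = 2 ^ 3))).symm ▸ rfl
  · exact (Nat.pow_right_injective le_rfl (h.symm.trans (by norm_num : (4 : ℕ) = 2 ^ 2))).symm ▸ rfl

/-- **THE 2-ADIC LOG IMAGE on the split-bad class**: `log_ω(X_d(ℚ₂)) = 2ℤ₂` if `d ≡ 3 (mod 8)`, `= ℤ₂` otherwise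
(b2b-bsdres' additive-prime law `log = p^{t − v_p c_p}ℤ_p` with bsd-goldfeld's `c₂(X_d) = 4` and `Addv X_d 2`).
[cite: Kim2022StructureSelmer, §3.2.3 (display before Thm. 3.7) and Lemma 3.10] [cite: SilvermanAEC2009, IV.6.4, VII.6.3] -/
theorem range_padicLog_cellTwist_two (hsq : Squarefree d) (hd4 : d % 4 ≠ 1) :
    (haveI := cm7.isElliptic_quadraticTwist (show (((4 * d : ℤ)) : ℚ) ≠ 0 by
       have := hsq.ne_zero; exact_mod_cast (show (4 * d : ℤ) ≠ 0 by omega))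
     haveI := GoldfeldGoodTwists.isGloballyMinimal_cellTwist hsq hd4
     (padicLog ((cm7.quadraticTwist (((4 * d : ℤ)) : ℚ)).baseChange ℚ_[2])).range) =
      (Submodule.span ℤ_[2] {(2 : ℚ_[2]) ^ (if d % 8 = 3 then (1 : ℤ) else 0)}).toAddSubgroup := by
  have hd : (((4 * d : ℤ)) : ℚ) ≠ 0 := by have := hsq.ne_zero; exact_mod_cast (show (4 * d : ℤ) ≠ 0 by omega)
  haveI := cm7.isElliptic_quadraticTwist hd
  haveI := GoldfeldGoodTwists.isGloballyMinimal_cellTwist hsq hd4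
  haveI : Fact (Nat.Prime 7) := ⟨by norm_num⟩
  have hadd := (GoldfeldGoodTwists.additive_two_seven_cellTwist hsq hd4).1
  rw [range_padicLog_baseChange_of_addv _ 2 hadd, padicValNat_card_torsion_cellTwist hsq hd4,
    GoldfeldGoodTwists.localTamagawaNumber_padic_cellTwist_two hsq hd4,
    show padicValNat 2 4 = 2 by rw [show (4 : ℕ) = 2 ^ 2 by norm_num, padicValNat.prime_pow]]
  split_ifs <;> norm_num

end CellModel

end Summit.BirchSwinnertonDyer.BirchSwinnertonDyer.Theorems.PrintCf2.DyadicTorsion
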